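import Summits.KontsevichZagierPeriods.KontsevichZagierPeriods.Theorems.SoloInformedAyoubSymbols
import Summits.KontsevichZagierPeriods.KontsevichZagierPeriods.Theorems.SoloInformedTorsionFree
import Summits.KontsevichZagierPeriods.KontsevichZagierPeriods.Statement
import HarnessLib

/-!
# SoloInformed — THEOREM D_A: Ayoub's form of the period conjecture implies the KZ-calculus form

Main result (`soloInformed_ayoubTransfer`):

  `SoloInformedAyoubLemmaQ → SoloInformedAyoubPresentation → SoloInformedAyoubKZeff →
     KontsevichZagierPeriods`.

Everything except the three named hypotheses is kernel-checked here. The mechanism: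

1. (Ψ, relations half — proved) the map `[a] ↦ [[0,1]ⁿ, Re a]` from Ayoub symbols to formal
   combinations of integral representations sends every Ayoub relation into the KZ relations:
   extensionality and additivity by integrand additivity, the inclusions `a ↦ a ∘ init` by the
   Newton–Leibniz move in a dummy last variable (`soloInformed_of_sub_of_comp_init_mem_relations`),
   and the Stokes elements by the general-dimension KZ–Stokes theorem on the cube
   (`soloInformed_kzStokes_cube`: Newton–Leibniz in the `i`-th variable after an affine permutation
   of coordinates, plus additivity);
2. (evaluation) `KZ.eval ∘ Ψ = Re ∘ Ev`;
3. (transfer) given representations `r, r'` with equal values, THEOREM P_A presents non-zero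
   multiples `k•[r]`, `k'•[r']` by real Ayoub symbols `x, x'`; `Ev (k'•x − k•x') = 0` (real parts by
   `relations ≤ ker eval`, imaginary parts by realness), so Ayoub's conjecture puts `k'•x − k•x'` in
   the Ayoub relations, Ψ puts `(k k')•([r] − [r'])` in the KZ relations, and FACT M (the formal
   period group is torsion-free, `soloInformed_equivalent_of_nsmul_sub_mem`) removes the multiple.

References: J. Ayoub, EMS Newsl. 91 (2014), Def. 9–10, Prop. 11, Rem. 12–13; Huber–Müller-Stach,
*Periods and Nori motives* (2017), Rem. 12.1.7 of the 2011 notes ("not clear to us if they also give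
all relations") — the present theorem is the typed comparison in the direction Ayoub ⇒ KZ-calculus,
conditional on LEMMA Q and THEOREM P_A.
-/

noncomputable section

open scoped BigOperators
open Set MeasureTheory
open Literature.NumberTheory.Transcendental Literature.NumberTheory.Transcendental.KZ

namespace Summit.KontsevichZagierPeriods.KontsevichZagierPeriods.Theorems

/-! ### Ψ on generators -/

section Psi

/-- The open neighbourhood of the cube provided by LEMMA Q for the generator `a`. -/
def soloInformedAyoubNbhd (hQ : SoloInformedAyoubLemmaQ)
    {n : ℕ} (a : SoloInformedAyoubGen n) : Set (Fin n → ℝ) :=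
  Classical.choose (hQ n a)

/-- The properties of `soloInformedAyoubNbhd`. -/
theorem soloInformedAyoubNbhd_spec (hQ : SoloInformedAyoubLemmaQ)
    {n : ℕ} (a : SoloInformedAyoubGen n) :
    IsOpen (soloInformedAyoubNbhd hQ a) ∧ soloInformedCube n ⊆ soloInformedAyoubNbhd hQ a ∧
    MapsTo (soloInformedToC n) (soloInformedAyoubNbhd hQ a) (Metric.ball 0 a.ρ) ∧
    IsSemialgebraicFunOn ℚ (soloInformedAyoubNbhd hQ a) (fun x => (a.f (soloInformedToC n x)).re) :=
  Classical.choose_spec (hQ n a)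

/-- Continuity of `a` along the real cube (granted LEMMA Q, which places the cube inside the
polydisc through an open neighbourhood). -/
theorem soloInformedAyoub_continuousOn_cube (hQ : SoloInformedAyoubLemmaQ)
    {n : ℕ} (a : SoloInformedAyoubGen n) :
    ContinuousOn (fun x => a.f (soloInformedToC n x)) (soloInformedCube n) :=
  (soloInformedAyoub_continuousOn a (soloInformedAyoubNbhd_spec hQ a).2.2.1).mono
    (soloInformedAyoubNbhd_spec hQ a).2.1

/-- A generator is real on the real cube (granted LEMMA Q, which places the cube inside the
polydisc). -/
theorem soloInformedAyoub_real_cube (hQ : SoloInformedAyoubLemmaQ)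
    {n : ℕ} (a : SoloInformedAyoubGen n) :
    ∀ x ∈ soloInformedCube n, (a.f (soloInformedToC n x)).im = 0 :=
  fun x hx =>
    a.real x ((soloInformedAyoubNbhd_spec hQ a).2.2.1 ((soloInformedAyoubNbhd_spec hQ a).2.1 hx))

/-- `Ψ[a] = [[0,1]ⁿ, Re a]` as an integral representation of the KZ calculus. -/
def soloInformedAyoubPsiRep (hQ : SoloInformedAyoubLemmaQ)
    {n : ℕ} (a : SoloInformedAyoubGen n) : IntegralRep n :=
  soloInformedCubeRep n (fun x => (a.f (soloInformedToC n x)).re)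
    ((soloInformedAyoubNbhd_spec hQ a).2.2.2.mono (soloInformedAyoubNbhd_spec hQ a).2.1
      (isSemialgebraic_soloInformedCube n))
    (Complex.continuous_re.comp_continuousOn (soloInformedAyoub_continuousOn_cube hQ a))

/-- Domain of `Ψ[a]`. -/
@[simp] theorem soloInformedAyoubPsiRep_domain (hQ : SoloInformedAyoubLemmaQ)
    {n : ℕ} (a : SoloInformedAyoubGen n) :
    (soloInformedAyoubPsiRep hQ a).domain = soloInformedCube n := rfl

/-- Integrand of `Ψ[a]`. -/
@[simp] theorem soloInformedAyoubPsiRep_integrand (hQ : SoloInformedAyoubLemmaQ)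
    {n : ℕ} (a : SoloInformedAyoubGen n) :
    (soloInformedAyoubPsiRep hQ a).integrand = fun x => (a.f (soloInformedToC n x)).re := rfl

/-- `Ψ : Symbols →+ FormalRep`, `[a] ↦ [Ψ[a]]`. -/
def soloInformedAyoubPsi (hQ : SoloInformedAyoubLemmaQ) : SoloInformedAyoubSymbols →+ FormalRep :=
  FreeAbelianGroup.lift fun a => of (soloInformedAyoubPsiRep hQ a.2)

/-- `Ψ` on a generator. -/
@[simp] theorem soloInformedAyoubPsi_of (hQ : SoloInformedAyoubLemmaQ)
    {n : ℕ} (a : SoloInformedAyoubGen n) :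
    soloInformedAyoubPsi hQ (soloInformedAyoubOf a) = of (soloInformedAyoubPsiRep hQ a) :=
  FreeAbelianGroup.lift_apply_of _ _

/-! ### Ψ kills the Ayoub relations -/

/-- (E) goes to integrand congruence. -/
theorem soloInformedAyoubPsi_ext (hQ : SoloInformedAyoubLemmaQ)
    {c : SoloInformedAyoubSymbols} (hc : c ∈ soloInformedAyoubExtRel) :
    soloInformedAyoubPsi hQ c ∈ relations := by
  obtain ⟨n, a, b, hab, rfl⟩ := hc
  rw [map_sub, soloInformedAyoubPsi_of, soloInformedAyoubPsi_of]
  exact of_sub_of_mem_relations_of_eqOn rfl fun x hx => by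
    simp only [soloInformedAyoubPsiRep_integrand, hab x hx]

/-- (A) goes to integrand additivity. -/
theorem soloInformedAyoubPsi_add (hQ : SoloInformedAyoubLemmaQ)
    {c : SoloInformedAyoubSymbols} (hc : c ∈ soloInformedAyoubAddRel) :
    soloInformedAyoubPsi hQ c ∈ relations := by
  obtain ⟨n, a, b, s, hs, rfl⟩ := hc
  rw [map_sub, map_sub, soloInformedAyoubPsi_of, soloInformedAyoubPsi_of, soloInformedAyoubPsi_of]
  exact integrandAddRel_subset_relations ⟨n, soloInformedAyoubPsiRep hQ s,
    soloInformedAyoubPsiRep hQ a, soloInformedAyoubPsiRep hQ b, rfl, rfl, fun x hx => by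
      simp only [soloInformedAyoubPsiRep_domain] at hx
      simp only [soloInformedAyoubPsiRep_integrand, Pi.add_apply, hs x hx, Complex.add_re], rfl⟩

/-- (I) goes to the Newton–Leibniz move in a dummy last variable. -/
theorem soloInformedAyoubPsi_init (hQ : SoloInformedAyoubLemmaQ) {c : SoloInformedAyoubSymbols}
    (hc : c ∈ soloInformedAyoubInitRel) : soloInformedAyoubPsi hQ c ∈ relations := by
  obtain ⟨n, a, e, he, rfl⟩ := hc
  rw [map_sub, soloInformedAyoubPsi_of, soloInformedAyoubPsi_of]
  exact soloInformed_of_sub_of_comp_init_mem_relations _ _ rfl rfl fun x hx => by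
    simp only [soloInformedAyoubPsiRep_integrand, he x hx]

/-- (S) goes to the KZ–Stokes theorem on the cube. -/
theorem soloInformedAyoubPsi_stokes (hQ : SoloInformedAyoubLemmaQ) {c : SoloInformedAyoubSymbols}
    (hc : c ∈ soloInformedAyoubStokesRel) : soloInformedAyoubPsi hQ c ∈ relations := by
  obtain ⟨n, i, a, b, t, s, hb, ht, hs, rfl⟩ := hc
  obtain ⟨hWo, hCW, hWb, hWs⟩ := soloInformedAyoubNbhd_spec hQ a
  have h := soloInformed_kzStokes_cube hWo hCW hWs (soloInformedAyoub_contDiffOn_re a hWb) i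
    (soloInformedAyoubPsiRep hQ b) rfl
    (fun x hx => by
      simp only [soloInformedAyoubPsiRep_integrand, hb x hx]
      exact (soloInformedAyoub_fderiv_re a (hWb (hCW hx)) i).symm)
    (soloInformedAyoubPsiRep hQ t) (soloInformedAyoubPsiRep hQ s) rfl rfl
    (fun y hy => by simp only [soloInformedAyoubPsiRep_integrand, ht y hy])
    (fun y hy => by simp only [soloInformedAyoubPsiRep_integrand, hs y hy])
  rw [map_add, map_sub, soloInformedAyoubPsi_of, soloInformedAyoubPsi_of, soloInformedAyoubPsi_of]
  have e : of (soloInformedAyoubPsiRep hQ b) - of (soloInformedAyoubPsiRep hQ t) +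
      of (soloInformedAyoubPsiRep hQ s) = of (soloInformedAyoubPsiRep hQ b) -
      (of (soloInformedAyoubPsiRep hQ t) - of (soloInformedAyoubPsiRep hQ s)) := by abel
  rw [e]; exact h

/-- **Ψ kills all Ayoub relations**: `Rel ≤ Ψ⁻¹(KZ relations)`. -/
theorem soloInformedAyoubPsi_rel (hQ : SoloInformedAyoubLemmaQ)
    {c : SoloInformedAyoubSymbols} (hc : c ∈ soloInformedAyoubRel) :
    soloInformedAyoubPsi hQ c ∈ relations := by
  have hle : soloInformedAyoubRel ≤ relations.comap (soloInformedAyoubPsi hQ) := by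
    refine (AddSubgroup.closure_le _).2 ?_
    rintro x (((hx | hx) | hx) | hx)
    · exact soloInformedAyoubPsi_ext hQ hx
    · exact soloInformedAyoubPsi_add hQ hx
    · exact soloInformedAyoubPsi_init hQ hx
    · exact soloInformedAyoubPsi_stokes hQ hx
  exact hle hc

/-! ### Evaluation -/

/-- `eval (Ψ x) = Re (Ev x)`. -/
theorem soloInformed_eval_psi (hQ : SoloInformedAyoubLemmaQ) (x : SoloInformedAyoubSymbols) :
    eval (soloInformedAyoubPsi hQ x) = (soloInformedAyoubEv x).re := by
  induction x using FreeAbelianGroup.induction_on with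
  | zero => simp
  | of a =>
    obtain ⟨n, a⟩ := a
    change eval (soloInformedAyoubPsi hQ (soloInformedAyoubOf a)) =
      (soloInformedAyoubEv (soloInformedAyoubOf a)).re
    rw [soloInformedAyoubPsi_of, eval_of, soloInformedAyoubEv_of_re a
      (soloInformedAyoub_continuousOn_cube hQ a)]
    rfl
  | neg a ih =>
    rw [map_neg, map_neg, map_neg, Complex.neg_re]
    exact congrArg Neg.neg ih
  | add x y hx hy => rw [map_add, map_add, map_add, Complex.add_re, hx, hy]

/-- A `ℤ`-combination of generators real on the cube has real evaluation. -/
theorem soloInformedAyoubEv_sum_im (hQ : SoloInformedAyoubLemmaQ)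
    {m : ℕ} {d : Fin m → ℕ} (a : ∀ j, SoloInformedAyoubGen (d j))
    (c : Fin m → ℤ) :
    (soloInformedAyoubEv (∑ j, c j • soloInformedAyoubOf (a j))).im = 0 := by
  rw [map_sum, Complex.im_sum]
  refine Finset.sum_eq_zero fun j _ => ?_
  rw [map_zsmul, zsmul_eq_mul, Complex.mul_im, soloInformedAyoubEv_of_im_eq_zero (a j)
    (soloInformedAyoub_continuousOn_cube hQ (a j)) (soloInformedAyoub_real_cube hQ (a j))]
  simp

/-- `Re (Ev x) = k · value r` whenever `Ψ x ≡ k • [r]` modulo the KZ relations. -/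
theorem soloInformedAyoubEv_re_eq (hQ : SoloInformedAyoubLemmaQ)
    {n : ℕ} (r : IntegralRep n) (k : ℕ) (x : SoloInformedAyoubSymbols)
    (h : soloInformedAyoubPsi hQ x - k • of r ∈ relations) :
    (soloInformedAyoubEv x).re = k * r.value := by
  have h0 : eval (soloInformedAyoubPsi hQ x - k • of r) = 0 := relations_le_ker_eval_holds h
  rw [map_sub, sub_eq_zero, soloInformed_eval_psi, map_nsmul, eval_of, nsmul_eq_mul] at h0
  exact h0

end Psi

/-! ### THEOREM D_A -/

/-- From a presentation `k • [r] ≡ Σ cⱼ • [ρⱼ]` with `ρⱼ = [[0,1]^{dⱼ}, Re aⱼ]` extract the Ayoub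
symbol `x = Σ cⱼ • [aⱼ]` with `Ψ x ≡ k • [r]`. -/
theorem soloInformedAyoubPsi_presentation (hQ : SoloInformedAyoubLemmaQ) {n : ℕ} (r : IntegralRep n)
    {k m : ℕ} {d : Fin m → ℕ} (a : ∀ j, SoloInformedAyoubGen (d j)) (c : Fin m → ℤ)
    (ρ : ∀ j, IntegralRep (d j)) (hρd : ∀ j, (ρ j).domain = soloInformedCube (d j))
    (hρi : ∀ j, EqOn (ρ j).integrand (fun x => ((a j).f (soloInformedToC (d j) x)).re)
      (soloInformedCube (d j)))
    (hrel : k • of r - ∑ j, c j • of (ρ j) ∈ relations) :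
    soloInformedAyoubPsi hQ (∑ j, c j • soloInformedAyoubOf (a j)) - k • of r ∈ relations := by
  have h1 : soloInformedAyoubPsi hQ (∑ j, c j • soloInformedAyoubOf (a j)) -
      ∑ j, c j • of (ρ j) ∈ relations := by
    rw [map_sum, ← Finset.sum_sub_distrib]
    refine AddSubgroup.sum_mem _ fun j _ => ?_
    rw [map_zsmul, soloInformedAyoubPsi_of, ← smul_sub]
    refine AddSubgroup.zsmul_mem _ (of_sub_of_mem_relations_of_eqOn (hρd j) fun x hx => ?_) (c j)
    simp only [soloInformedAyoubPsiRep_integrand]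
    exact (hρi j hx).symm
  have e : soloInformedAyoubPsi hQ (∑ j, c j • soloInformedAyoubOf (a j)) - k • of r =
      (soloInformedAyoubPsi hQ (∑ j, c j • soloInformedAyoubOf (a j)) - ∑ j, c j • of (ρ j)) -
      (k • of r - ∑ j, c j • of (ρ j)) := by abel
  rw [e]
  exact relations.sub_mem h1 hrel

/-- **THEOREM D_A.** LEMMA Q, THEOREM P_A and Ayoub's (effective) form of the period conjecture
together imply the Kontsevich–Zagier period conjecture in the KZ-calculus form of the summit.
Conditional on exactly the three displayed hypotheses; the deduction is kernel-checked.
[Ayoub 2014, Def. 10, Prop. 11, Rem. 13; Kontsevich–Zagier 2001, §1.2] -/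
theorem soloInformed_ayoubTransfer (hQ : SoloInformedAyoubLemmaQ)
    (hP : SoloInformedAyoubPresentation) (hA : SoloInformedAyoubKZeff) :
    KontsevichZagierPeriods := by
  refine KontsevichZagierPeriods_iff.2 fun n n' r r' _ _ hv => ?_
  obtain ⟨k, hk, m, d, a, c, ρ, hρd, hρi, hrel⟩ := hP n r
  obtain ⟨k', hk', m', d', a', c', ρ', hρd', hρi', hrel'⟩ := hP n' r'
  set x : SoloInformedAyoubSymbols := ∑ j, c j • soloInformedAyoubOf (a j) with hx
  set x' : SoloInformedAyoubSymbols := ∑ j, c' j • soloInformedAyoubOf (a' j) with hx'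
  have hψ : soloInformedAyoubPsi hQ x - k • of r ∈ relations :=
    soloInformedAyoubPsi_presentation hQ r a c ρ hρd hρi hrel
  have hψ' : soloInformedAyoubPsi hQ x' - k' • of r' ∈ relations :=
    soloInformedAyoubPsi_presentation hQ r' a' c' ρ' hρd' hρi' hrel'
  -- the symbol `y = k' • x - k • x'` has evaluation zero
  have hre := soloInformedAyoubEv_re_eq hQ r k x hψ
  have hre' := soloInformedAyoubEv_re_eq hQ r' k' x' hψ'
  have him : (soloInformedAyoubEv x).im = 0 := soloInformedAyoubEv_sum_im hQ a c
  have him' : (soloInformedAyoubEv x').im = 0 := soloInformedAyoubEv_sum_im hQ a' c'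
  have hy : soloInformedAyoubEv (k' • x - k • x') = 0 := by
    apply Complex.ext
    · rw [map_sub, map_nsmul, map_nsmul, nsmul_eq_mul, nsmul_eq_mul, Complex.sub_re,
        Complex.mul_re, Complex.mul_re, hre, hre', him, him', hv]
      simp only [Complex.natCast_re, Complex.natCast_im, zero_mul, sub_zero, Complex.zero_re]
      ring
    · rw [map_sub, map_nsmul, map_nsmul, nsmul_eq_mul, nsmul_eq_mul, Complex.sub_im,
        Complex.mul_im, Complex.mul_im, hre, hre', him, him']
      simp
  -- Ayoub's conjecture: `y` is an Ayoub relation, so `Ψ y` is a KZ relation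
  have hΨy : soloInformedAyoubPsi hQ (k' • x - k • x') ∈ relations :=
    soloInformedAyoubPsi_rel hQ (hA _ hy)
  -- hence `(k * k') • ([r] - [r'])` is a KZ relation
  have hkk : (k * k') • (of r - of r') ∈ relations := by
    have e : (k * k') • (of r - of r') = soloInformedAyoubPsi hQ (k' • x - k • x') -
        k' • (soloInformedAyoubPsi hQ x - k • of r) +
        k • (soloInformedAyoubPsi hQ x' - k' • of r') := by
      rw [map_sub, map_nsmul, map_nsmul, smul_sub, smul_sub, smul_sub, ← mul_smul, ← mul_smul,
        mul_comm k' k]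
      abel
    rw [e]
    exact relations.add_mem (relations.sub_mem hΨy (relations.nsmul_mem hψ k'))
      (relations.nsmul_mem hψ' k)
  exact soloInformed_equivalent_of_nsmul_sub_mem (mul_ne_zero hk hk') hkk

end Summit.KontsevichZagierPeriods.KontsevichZagierPeriods.Theorems
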